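import Literature.AlgebraicGeometry.ShimuraVarieties.UnitaryBallAutomorphicForms
import Literature.Geometry.ComplexHyperbolic.UnitBallQuotientManifold
import Literature.NumberTheory.Transcendental.ProjectiveSpaceProofs
import Literature.Analysis.Complex.OsgoodProofs
import Mathlib.Geometry.Manifold.Algebra.LieGroup
import Mathlib.Analysis.Calculus.InverseFunctionTheorem.FDeriv
import HarnessLib

/-!
# Maps to projective space from holomorphic automorphic forms on the ball `𝔹²`

Let `Δ ≤ U(2,1)` act on the unit ball `𝔹² ⊂ ℂ²` (the tree's `BallModel.Ball`, an open complex
submanifold of `ℂ²`, `UnitBallQuotientManifold.lean`) and let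
`holFactorForms Δ (canonicalCocycle ℂ k)` be the holomorphic automorphic forms of weight `k` for the
canonical factor `J(g, z) = det D(g)(z)` (`UnitaryBallAutomorphicForms.lean`): holomorphic `f` on `𝔹²`
with `f z = J(δ, z)ᵏ f (δ • z)` for `δ ∈ Δ`. This file is the first of three
(`UnitaryBallProjectiveMaps` → `UnitaryBallProjectiveSystems` → `UnitaryBallProjectiveEmbedding`)
assembling **Shafarevich's theorem** (*Basic Algebraic Geometry 2*, Ch. IX §3.2, Theorem, cocompact
case): from point separation and tangent separation by such forms, a finite system of forms of one
weight embeds the compact quotient `Δ\𝔹²` into `ℙᴺ(ℂ)`. Here (all PROVED, theorems only):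

* §1 algebra: `apply_smul_eq` (`f (δ • z) = (J(δ,z)ᵏ)⁻¹ f z`), `mul_mem`, `pow_mem`, `mul_pow_mem`
  (the graded ring structure);
* §2 analysis of the zero extensions `extend ℂ f` at ball points (Osgood: analytic, `C^ω`, strict
  derivative, continuous `fderiv`; `contMDiff_of_mem_holomorphic`: holomorphic maps of the manifold `𝔹²`);
* §3 the map `z ↦ [g₀(z) : ⋯ : g_N(z)]` to `ℙᴺ(ℂ)` (the tree's charted `Projectivization`,
  `NumberTheory/Transcendental/ProjectiveSpace.lean`) of holomorphic `gᵢ` without common zero: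
  `contMDiffAt_projectivizationMk` (any manifold source), `contMDiff_projectivizationMk`,
  `hasMFDerivAt_projectivizationMk`, and the **immersion criterion** `injective_mfderiv_projectivizationMk`:
  the differential at `z` is injective as soon as no non-zero `u` has `dgᵢ(z)u = μ gᵢ(z)` for all `i`
  (`exists_eq_mul_of_mfderiv_eq_zero`);
* §4 `exists_isOpen_eq_of_proportional`: at such an immersive point the map is injective on a
  neighbourhood (strict differentiability + a lower bound for the injective differential);
* §5 descent through the projection `mk : 𝔹² → Δ\𝔹²` (a holomorphic local diffeomorphism,
  `BallModel.isLocalDiffeomorph_mk`): `contMDiff_of_comp_mk`, `injective_mfderiv_of_comp_mk`.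

The pattern of §3 follows `Literature/Geometry/Kaehler/SiegelTorusThetaEmbedding.lean`
(`contMDiffAt_projectivizationMk` there, for vector-space sources); it is re-proved here for manifold
sources and for the open submanifold `𝔹²`, whose chart is the inclusion (`extChartAt_symm_apply_coe`).

References: I. R. Shafarevich, *Basic Algebraic Geometry 2* (Springer 1994), Ch. IX §3.1–3.2
(held: `book:shafarevich1994-basic-algebraic-geometry-2-schemes-amd-complex`, chunks p0267–p0271);
P. Griffiths, J. Harris, *Principles of Algebraic Geometry* (1978), Ch. 0 §2 (maps to `ℙⁿ`), Ch. 1 §4;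
N. Bergeron, J. Millson, C. Moeglin, Acta Math. 216 (2016), Introduction §1.1 (`Γ\𝔹ⁿ` as a complex
manifold).

## Provenance

Written for the pub-hodgecm2 cell (COR-CM, Hodge ladder stage 2), LIT-FANOUT row D4 (c3), claim
`D4-6-asm` (seat b06): the assembly engine retiring the displayed binder `PicardCM.BallQuotientUniformised`
once the pointwise separation statements (rows D4 (c1), (c2)) land. Theorems only; no definitions, no
named facts.
-/

set_option autoImplicit false

noncomputable section

open scoped Manifold ContDiff Topology LinearAlgebra.Projectivization
open Set Filter MulAction
open Literature.Geometry.ComplexHyperbolic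
open Literature.Geometry.ComplexHyperbolic.BallModel (U21 Ball nsq)
open Literature.NumberTheory.Automorphic.AutomorphyFactor

namespace Literature.AlgebraicGeometry.ShimuraVarieties

namespace BallProjective

open BallForms (holFactorForms canonicalCocycle canonicalFactor extend holomorphic ballSet
  canonicalFactor_ne_zero isOpen_ballSet)

variable {Δ : Subgroup U21}

/-! ### §1 Algebra of holomorphic forms of the canonical cocycle -/

/-- Automorphy of a form of weight `k`: `f z = J(δ, z)ᵏ f (δ • z)`. [cite: Shafarevich1994, Ch. IX §3.1, Definition (automorphic form of weight k)] -/
theorem apply_eq_mul_apply_smul {k : ℕ} {f : Ball → ℂ}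
    (hf : f ∈ holFactorForms Δ (canonicalCocycle ℂ k)) (δ : Δ) (z : Ball) :
    f z = canonicalFactor (δ : U21) z ^ k * f (δ • z) := by
  have h := (BallForms.mem_holFactorForms_iff.1 hf).1 (δ : U21) δ.2 z
  rw [BallForms.canonicalCocycle_apply, smul_eq_mul] at h
  exact h

/-- The translate of a form is a non-zero multiple of the form:
`f (δ • z) = (J(δ, z)ᵏ)⁻¹ f z`. [cite: Shafarevich1994, Ch. IX §3.1, Definition (automorphic form of weight k)] -/
theorem apply_smul_eq {k : ℕ} {f : Ball → ℂ}
    (hf : f ∈ holFactorForms Δ (canonicalCocycle ℂ k)) (δ : Δ) (z : Ball) :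
    f (δ • z) = (canonicalFactor (δ : U21) z ^ k)⁻¹ * f z := by
  rw [apply_eq_mul_apply_smul hf δ z, ← mul_assoc,
    inv_mul_cancel₀ (pow_ne_zero k (canonicalFactor_ne_zero _ _)), one_mul]

/-- Products of forms are forms, with weights adding. [cite: Shafarevich1994, Ch. IX §3.2, proof of the Theorem (products of automorphic forms have the product weight)] -/
theorem mul_mem {k l : ℕ} {f g : Ball → ℂ}
    (hf : f ∈ holFactorForms Δ (canonicalCocycle ℂ k))
    (hg : g ∈ holFactorForms Δ (canonicalCocycle ℂ l)) :
    f * g ∈ holFactorForms Δ (canonicalCocycle ℂ (k + l)) := by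
  rw [BallForms.mem_holFactorForms_iff] at hf hg ⊢
  refine ⟨fun γ hγ z ↦ ?_, ?_⟩
  · have h1 := hf.1 γ hγ z
    have h2 := hg.1 γ hγ z
    rw [BallForms.canonicalCocycle_apply, smul_eq_mul] at h1 h2 ⊢
    rw [Pi.mul_apply, Pi.mul_apply, h1, h2, pow_add]
    ring
  · have he : extend ℂ (f * g) = extend ℂ f * extend ℂ g := by
      funext w
      by_cases h : nsq w < 1
      · simp only [BallForms.extend, dif_pos h, Pi.mul_apply]
      · simp only [BallForms.extend, dif_neg h, Pi.mul_apply, mul_zero]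
    change DifferentiableOn ℂ (extend ℂ (f * g)) ballSet
    rw [he]
    exact hf.2.mul hg.2

/-- Powers of forms are forms. [cite: Shafarevich1994, Ch. IX §3.2, proof of the Theorem (products of automorphic forms have the product weight)] -/
theorem pow_mem {k : ℕ} {f : Ball → ℂ} (hf : f ∈ holFactorForms Δ (canonicalCocycle ℂ k)) :
    ∀ n : ℕ, f ^ n ∈ holFactorForms Δ (canonicalCocycle ℂ (k * n))
  | 0 => by
    rw [pow_zero, mul_zero, BallForms.mem_holFactorForms_iff]
    refine ⟨fun γ hγ z ↦ by simp, ?_⟩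
    change DifferentiableOn ℂ (extend ℂ (1 : Ball → ℂ)) ballSet
    refine (differentiableOn_const (1 : ℂ)).congr fun w hw ↦ ?_
    simp only [BallForms.extend, dif_pos (show nsq w < 1 from hw)]
    rfl
  | n + 1 => by
    rw [pow_succ, mul_add, mul_one]
    exact mul_mem (pow_mem hf n) hf

/-- The raised form `f · h ^ j` of weight `k (j + 1)`. [cite: Shafarevich1994, Ch. IX §3.2, proof of the Theorem (products of automorphic forms have the product weight)] -/
theorem mul_pow_mem {k j : ℕ} {f h : Ball → ℂ} (hf : f ∈ holFactorForms Δ (canonicalCocycle ℂ k))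
    (hh : h ∈ holFactorForms Δ (canonicalCocycle ℂ k)) :
    f * h ^ j ∈ holFactorForms Δ (canonicalCocycle ℂ (k * (j + 1))) := by
  have := mul_mem hf (pow_mem hh j)
  rwa [mul_add_one, add_comm]

/-! ### §2 Analytic properties of holomorphic functions on the ball -/

/-- The zero extension of a holomorphic function on the ball is analytic at ball points (Osgood).
[cite: HormanderSCV1973, Thm 2.2.1 and Thm 2.2.6] -/
theorem analyticAt_extend {f : Ball → ℂ} (hf : f ∈ holomorphic ℂ) (z : Ball) :
    AnalyticAt ℂ (extend ℂ f) z.1 :=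
  Literature.Analysis.Complex.SCV.analyticAt_of_differentiableOn hf isOpen_ballSet z.2

/-- The zero extension of a holomorphic function on the ball is `C^ω` at ball points. [cite: HormanderSCV1973, Thm 2.2.1 and Thm 2.2.6] -/
theorem contDiffAt_extend {f : Ball → ℂ} (hf : f ∈ holomorphic ℂ) (z : Ball) {n : ℕ∞ω} :
    ContDiffAt ℂ n (extend ℂ f) z.1 :=
  (analyticAt_extend hf z).contDiffAt

/-- The zero extension is `C^ω` on the open ball. [cite: HormanderSCV1973, Thm 2.2.1 and Thm 2.2.6] -/
theorem contDiffOn_extend {f : Ball → ℂ} (hf : f ∈ holomorphic ℂ) {n : ℕ∞ω} :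
    ContDiffOn ℂ n (extend ℂ f) ballSet :=
  fun w hw ↦ (contDiffAt_extend hf ⟨w, hw⟩).contDiffWithinAt

/-- A holomorphic function on the ball is a holomorphic (`C^ω`) map of the complex manifold `𝔹²`.
[cite: HormanderSCV1973, Thm 2.2.1 and Thm 2.2.6] -/
theorem contMDiff_of_mem_holomorphic {f : Ball → ℂ} (hf : f ∈ holomorphic ℂ) {n : ℕ∞ω} :
    ContMDiff 𝓘(ℂ, Fin 2 → ℂ) 𝓘(ℂ, ℂ) n f := by
  have heq : f = extend ℂ f ∘ fun z : Ball ↦ (z.1 : Fin 2 → ℂ) :=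
    funext fun z ↦ (BallForms.extend_apply_coe f z).symm
  rw [heq]
  exact (contDiffOn_extend hf).contMDiffOn.comp_contMDiff BallModel.contMDiff_coe
    fun z ↦ BallForms.coe_mem_ballSet z

/-- The derivative `w ↦ D(extend f)(w)` is continuous on the open ball. [cite: HormanderSCV1973, Thm 2.2.1 and Thm 2.2.6] -/
theorem continuousOn_fderiv_extend {f : Ball → ℂ} (hf : f ∈ holomorphic ℂ) :
    ContinuousOn (fun w ↦ fderiv ℂ (extend ℂ f) w) ballSet :=
  ((contDiffOn_extend hf (n := 1)).continuousOn_fderiv_of_isOpen isOpen_ballSet le_rfl)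

/-- `z ↦ D(extend f)(z)` is continuous on `𝔹²`. [cite: HormanderSCV1973, Thm 2.2.1 and Thm 2.2.6] -/
theorem continuous_fderiv_extend {f : Ball → ℂ} (hf : f ∈ holomorphic ℂ) :
    Continuous (fun z : Ball ↦ fderiv ℂ (extend ℂ f) z.1) :=
  (continuousOn_fderiv_extend hf).comp_continuous continuous_subtype_val BallForms.coe_mem_ballSet

/-- The zero extension has a strict derivative at ball points. [cite: HormanderSCV1973, Thm 2.2.1 and Thm 2.2.6] -/
theorem hasStrictFDerivAt_extend {f : Ball → ℂ} (hf : f ∈ holomorphic ℂ) (z : Ball) :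
    HasStrictFDerivAt (extend ℂ f) (fderiv ℂ (extend ℂ f) z.1) z.1 :=
  (contDiffAt_extend hf z (n := 1)).hasStrictFDerivAt one_ne_zero


/-! ### §3 Maps to projective space given by holomorphic homogeneous coordinates -/

section ProjectiveMaps

variable {N : ℕ}

/-- The index of the standard chart chosen at `[v]` is a non-vanishing coordinate of `v`. [cite: GriffithsHarris1978, Ch. 0 §2 p. 15] -/
theorem apply_chartIndex_ne_zero {v : Fin (N + 1) → ℂ} (hv : v ≠ 0) {i₀ : Fin (N + 1)}
    (hi₀ : Classical.choose (Projectivization.exists_rep_apply_ne_zero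
      (Projectivization.mk ℂ v hv)) = i₀) :
    v i₀ ≠ 0 := by
  have hrep := Classical.choose_spec (Projectivization.exists_rep_apply_ne_zero
    (Projectivization.mk ℂ v hv))
  rw [hi₀] at hrep
  exact (Projectivization.mk_mem_stdChartSource_iff i₀ v hv).mp hrep

/-- **`y ↦ [g(y)]` is `C^n` on a manifold** when the homogeneous coordinates `g_k : M → ℂ` are `C^n`
without common zero: in the standard chart at `[g(x)]` the map reads
`y ↦ (g_{i₀.succAbove j}(y) / g_{i₀}(y))_j`. [cite: GriffithsHarris1978, Ch. 0 §2 p. 15] -/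
theorem contMDiffAt_projectivizationMk {E' H M : Type*} [NormedAddCommGroup E'] [NormedSpace ℂ E']
    [TopologicalSpace H] {I : ModelWithCorners ℂ E' H} [TopologicalSpace M] [ChartedSpace H M]
    {n : ℕ∞ω} {g : M → Fin (N + 1) → ℂ} (hnz : ∀ y, g y ≠ 0) {x : M}
    (hg : ∀ k, ContMDiffAt I 𝓘(ℂ, ℂ) n (fun y ↦ g y k) x) :
    ContMDiffAt I 𝓘(ℂ, Fin N → ℂ) n (fun y ↦ Projectivization.mk ℂ (g y) (hnz y)) x := by
  obtain ⟨i₀, hi₀⟩ : ∃ i₀ : Fin (N + 1), Classical.choose (Projectivization.exists_rep_apply_ne_zero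
      (Projectivization.mk ℂ (g x) (hnz x))) = i₀ := ⟨_, rfl⟩
  have hgi := apply_chartIndex_ne_zero (hnz x) hi₀
  have hgc : ContinuousAt g x := continuousAt_pi.2 fun k ↦ (hg k).continuousAt
  rw [contMDiffAt_iff_target]
  refine ⟨?_, ?_⟩
  · have h1 : ContinuousAt (fun y ↦ (⟨g y, hnz y⟩ : {v : Fin (N + 1) → ℂ // v ≠ 0})) x :=
      Topology.IsInducing.subtypeVal.continuousAt_iff.2 hgc
    exact Projectivization.continuous_mk'.continuousAt.comp h1
  · have hfun : (extChartAt 𝓘(ℂ, Fin N → ℂ) (Projectivization.mk ℂ (g x) (hnz x)) ∘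
        fun y ↦ Projectivization.mk ℂ (g y) (hnz y)) =
        fun y j ↦ g y (i₀.succAbove j) / g y i₀ := by
      funext y
      simp [Projectivization.chartAt_eq, hi₀]
    rw [hfun]
    exact contMDiffAt_pi_space.2 fun j ↦ (hg _).div₀ (hg i₀) hgi

variable {g : Fin (N + 1) → Ball → ℂ}

/-- **The map `z ↦ [g₀(z) : … : g_N(z)]` of a system of holomorphic functions without common zero is a
holomorphic map `𝔹² → ℙᴺ(ℂ)`.** [cite: GriffithsHarris1978, Ch. 0 §2 p. 15] -/
theorem contMDiff_projectivizationMk (hg : ∀ i, g i ∈ holomorphic ℂ)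
    (hnz : ∀ z : Ball, (fun i ↦ g i z) ≠ 0) {n : ℕ∞ω} :
    ContMDiff 𝓘(ℂ, Fin 2 → ℂ) 𝓘(ℂ, Fin N → ℂ) n
      (fun z ↦ Projectivization.mk ℂ (fun i ↦ g i z) (hnz z)) :=
  fun _ ↦ contMDiffAt_projectivizationMk hnz fun k ↦ (contMDiff_of_mem_holomorphic (hg k)).contMDiffAt

/-- The chart of `𝔹²` is the inclusion: `(extChartAt z).symm w = w` for `w ∈ 𝔹²`. [cite: Rudin1980, §2.2] -/
theorem extChartAt_symm_apply_coe (z w : Ball) : (extChartAt 𝓘(ℂ, Fin 2 → ℂ) z).symm w.1 = w := by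
  simp only [extChartAt, OpenPartialHomeomorph.extend, PartialEquiv.coe_trans_symm,
    OpenPartialHomeomorph.coe_toPartialEquiv_symm, ModelWithCorners.toPartialEquiv_coe_symm,
    modelWithCornersSelf_coe_symm, Function.comp_apply, id_eq]
  exact BallModel.isOpenEmbedding_coe.toOpenPartialHomeomorph_left_inv

/-- **The differential of `z ↦ [g(z)]` on the ball**, in the standard chart at `[g(z)]`: the derivative
of `w ↦ (g_{i₀.succAbove j}(w) / g_{i₀}(w))_j` (zero extensions) at `z`.
[cite: GriffithsHarris1978, Ch. 0 §2 p. 15] -/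
theorem hasMFDerivAt_projectivizationMk (hg : ∀ i, g i ∈ holomorphic ℂ)
    (hnz : ∀ z : Ball, (fun i ↦ g i z) ≠ 0) (z : Ball) {i₀ : Fin (N + 1)}
    (hi₀ : Classical.choose (Projectivization.exists_rep_apply_ne_zero
      (Projectivization.mk ℂ (fun i ↦ g i z) (hnz z))) = i₀) :
    HasMFDerivAt 𝓘(ℂ, Fin 2 → ℂ) 𝓘(ℂ, Fin N → ℂ)
      (fun z ↦ Projectivization.mk ℂ (fun i ↦ g i z) (hnz z)) z
      (ContinuousLinearMap.pi fun j ↦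
        fderiv ℂ (fun w ↦ extend ℂ (g (i₀.succAbove j)) w * (extend ℂ (g i₀) w)⁻¹) z.1) := by
  have hgi : g i₀ z ≠ 0 := apply_chartIndex_ne_zero (hnz z) hi₀
  refine ⟨(contMDiff_projectivizationMk hg hnz (n := ω) z).continuousAt, ?_⟩
  -- the map read in the charts agrees near `z` with the quotient of zero extensions
  have hev : writtenInExtChartAt 𝓘(ℂ, Fin 2 → ℂ) 𝓘(ℂ, Fin N → ℂ) z
      (fun z ↦ Projectivization.mk ℂ (fun i ↦ g i z) (hnz z)) =ᶠ[𝓝 z.1]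
      fun w j ↦ extend ℂ (g (i₀.succAbove j)) w * (extend ℂ (g i₀) w)⁻¹ := by
    filter_upwards [isOpen_ballSet.mem_nhds (BallForms.coe_mem_ballSet z)] with w hw
    have hw' : (extChartAt 𝓘(ℂ, Fin 2 → ℂ) z).symm w = ⟨w, hw⟩ :=
      extChartAt_symm_apply_coe z ⟨w, hw⟩
    funext j
    simp only [writtenInExtChartAt, Function.comp_apply, hw']
    simp [Projectivization.chartAt_eq, hi₀, div_eq_mul_inv, BallForms.extend_apply_coe _ ⟨w, hw⟩]
  have h0 : extend ℂ (g i₀) z.1 ≠ 0 := by rwa [BallForms.extend_apply_coe]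
  have hφd : HasFDerivAt (fun w j ↦ extend ℂ (g (i₀.succAbove j)) w * (extend ℂ (g i₀) w)⁻¹)
      (ContinuousLinearMap.pi fun j ↦
        fderiv ℂ (fun w ↦ extend ℂ (g (i₀.succAbove j)) w * (extend ℂ (g i₀) w)⁻¹) z.1) z.1 :=
    hasFDerivAt_pi.2 fun j ↦ ((BallForms.differentiableAt_extend (hg _) z).mul
      ((BallForms.differentiableAt_extend (hg i₀) z).inv h0)).hasFDerivAt
  rw [modelWithCornersSelf_coe, Set.range_id]
  exact (hφd.congr_of_eventuallyEq hev).hasFDerivWithinAt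


/-- **Kernel of the differential in ratio coordinates**: if the derivative at `z` of every ratio
`g_k / g_{i₀}` (zero extensions, `g_{i₀}(z) ≠ 0`) kills `u`, then `dg_k(z)(u) = μ g_k(z)` for one `μ` and
all `k` (write `g_k = (g_k/g_{i₀}) · g_{i₀}` near `z` and differentiate).
[cite: GriffithsHarris1978, Ch. 0 §2 p. 15] -/
theorem exists_eq_mul_of_fderiv_ratio_eq_zero {ι : Type*} {g : ι → Ball → ℂ}
    (hg : ∀ i, g i ∈ holomorphic ℂ) (z : Ball) {i₀ : ι} (hgi : g i₀ z ≠ 0) {u : Fin 2 → ℂ}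
    (hu : ∀ k, fderiv ℂ (fun w ↦ extend ℂ (g k) w * (extend ℂ (g i₀) w)⁻¹) z.1 u = 0) :
    ∃ μ : ℂ, ∀ k, fderiv ℂ (extend ℂ (g k)) z.1 u = μ * g k z := by
  have hgi' : extend ℂ (g i₀) z.1 ≠ 0 := by rwa [BallForms.extend_apply_coe]
  have hd : ∀ k, DifferentiableAt ℂ (extend ℂ (g k)) z.1 := fun k ↦
    BallForms.differentiableAt_extend (hg k) z
  have hφd : ∀ k, DifferentiableAt ℂ
      (fun w ↦ extend ℂ (g k) w * (extend ℂ (g i₀) w)⁻¹) z.1 := fun k ↦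
    (hd _).mul ((hd i₀).inv hgi')
  have hloc : ∀ k, (fun w ↦ extend ℂ (g k) w) =ᶠ[𝓝 z.1]
      fun w ↦ (extend ℂ (g k) w * (extend ℂ (g i₀) w)⁻¹) * extend ℂ (g i₀) w := by
    intro k
    have hci : ContinuousAt (fun w ↦ extend ℂ (g i₀) w) z.1 := (hd i₀).continuousAt
    filter_upwards [hci.eventually_ne hgi'] with w hw
    rw [inv_mul_cancel_right₀ hw]
  refine ⟨fderiv ℂ (extend ℂ (g i₀)) z.1 u * (g i₀ z)⁻¹, fun k ↦ ?_⟩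
  have h1 : fderiv ℂ (extend ℂ (g k)) z.1 =
      fderiv ℂ (fun w ↦ (extend ℂ (g k) w * (extend ℂ (g i₀) w)⁻¹) * extend ℂ (g i₀) w) z.1 :=
    (hloc k).fderiv_eq
  rw [h1, fderiv_fun_mul (hφd k) (hd i₀)]
  simp only [_root_.add_apply, FunLike.coe_smul, Pi.smul_apply, smul_eq_mul, hu k, mul_zero,
    add_zero, BallForms.extend_apply_coe]
  field_simp

/-- **A tangent vector killed by `d[g]` is an infinitesimal rescaling**: if `u` is in the kernel of the
differential of `z ↦ [g(z)]` at `z`, then `dg_k(z)(u) = μ g_k(z)` for one `μ` and all `k`.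
[cite: GriffithsHarris1978, Ch. 0 §2 p. 15] -/
theorem exists_eq_mul_of_mfderiv_eq_zero (hg : ∀ i, g i ∈ holomorphic ℂ)
    (hnz : ∀ z : Ball, (fun i ↦ g i z) ≠ 0) (z : Ball) {u : Fin 2 → ℂ}
    (hu : mfderiv 𝓘(ℂ, Fin 2 → ℂ) 𝓘(ℂ, Fin N → ℂ)
      (fun z ↦ Projectivization.mk ℂ (fun i ↦ g i z) (hnz z)) z u = 0) :
    ∃ μ : ℂ, ∀ k, fderiv ℂ (extend ℂ (g k)) z.1 u = μ * g k z := by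
  obtain ⟨i₀, hi₀⟩ : ∃ i₀ : Fin (N + 1), Classical.choose (Projectivization.exists_rep_apply_ne_zero
      (Projectivization.mk ℂ (fun i ↦ g i z) (hnz z))) = i₀ := ⟨_, rfl⟩
  have hgi : g i₀ z ≠ 0 := apply_chartIndex_ne_zero (hnz z) hi₀
  have hgi' : extend ℂ (g i₀) z.1 ≠ 0 := by rwa [BallForms.extend_apply_coe]
  rw [(hasMFDerivAt_projectivizationMk hg hnz z hi₀).mfderiv] at hu
  refine exists_eq_mul_of_fderiv_ratio_eq_zero hg z hgi fun k ↦ ?_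
  rcases Fin.eq_self_or_eq_succAbove i₀ k with rfl | ⟨j, rfl⟩
  · -- the ratio `g_{i₀}/g_{i₀}` is `1` near `z`
    have hci : ContinuousAt (fun w ↦ extend ℂ (g k) w) z.1 :=
      (BallForms.differentiableAt_extend (hg k) z).continuousAt
    have hloc : (fun w ↦ extend ℂ (g k) w * (extend ℂ (g k) w)⁻¹) =ᶠ[𝓝 z.1] fun _ ↦ (1 : ℂ) := by
      filter_upwards [hci.eventually_ne hgi'] with w hw
      rw [mul_inv_cancel₀ hw]
    rw [hloc.fderiv_eq]
    simp
  · exact congrFun hu j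

/-- **Immersion criterion**: if no non-zero tangent vector `u` at `z` satisfies `dg_k(z)(u) = μ g_k(z)`
for all `k`, the differential of `z ↦ [g(z)]` at `z` is injective.
[cite: GriffithsHarris1978, Ch. 0 §2 p. 15; Ch. 1 §4 (embeddings by sections)] -/
theorem injective_mfderiv_projectivizationMk (hg : ∀ i, g i ∈ holomorphic ℂ)
    (hnz : ∀ z : Ball, (fun i ↦ g i z) ≠ 0) (z : Ball)
    (himm : ∀ (u : Fin 2 → ℂ) (μ : ℂ), (∀ k, fderiv ℂ (extend ℂ (g k)) z.1 u = μ * g k z) → u = 0) :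
    Function.Injective (mfderiv 𝓘(ℂ, Fin 2 → ℂ) 𝓘(ℂ, Fin N → ℂ)
      (fun z ↦ Projectivization.mk ℂ (fun i ↦ g i z) (hnz z)) z) := by
  refine (injective_iff_map_eq_zero _).2 fun u hu ↦ ?_
  obtain ⟨μ, hμ⟩ := exists_eq_mul_of_mfderiv_eq_zero hg hnz z hu
  exact himm u μ hμ

/-- Two points with proportional non-zero coordinate vectors have the same image in `ℙᴺ`; conversely.
[cite: GriffithsHarris1978, Ch. 0 §2 p. 15] -/
theorem projectivizationMk_eq_iff (hnz : ∀ z : Ball, (fun i ↦ g i z) ≠ 0) (z w : Ball) :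
    Projectivization.mk ℂ (fun i ↦ g i z) (hnz z) = Projectivization.mk ℂ (fun i ↦ g i w) (hnz w) ↔
      ∃ c : ℂ, ∀ i, g i z = c * g i w := by
  rw [Projectivization.mk_eq_mk_iff']
  constructor
  · rintro ⟨a, ha⟩
    exact ⟨a, fun i ↦ by simpa using (congrFun ha i).symm⟩
  · rintro ⟨c, hc⟩
    exact ⟨c, funext fun i ↦ by simpa using (hc i).symm⟩

/-! ### §4 An immersive point has a neighbourhood on which `[g]` is injective -/

/-- **Local injectivity at an immersive point.** If `g_{i₀}(z) ≠ 0` and the differential of `[g]` at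
`z` is injective (kernel form), then on an open neighbourhood of `z` in `𝔹²` no two distinct points
have proportional coordinate vectors `g(w₂) = c · g(w₁)`: the ratio map `w ↦ (g_k(w)/g_{i₀}(w))_k` has a
strict derivative at `z` which is injective, hence bounded below, so the map is injective near `z`.
[cite: GriffithsHarris1978, Ch. 0 §2 p. 15; Ch. 1 §4] -/
theorem exists_isOpen_eq_of_proportional {ι : Type*} [Fintype ι] {g : ι → Ball → ℂ}
    (hg : ∀ i, g i ∈ holomorphic ℂ) {z : Ball} {i₀ : ι} (hgi : g i₀ z ≠ 0)
    (himm : ∀ (u : Fin 2 → ℂ) (μ : ℂ), (∀ k, fderiv ℂ (extend ℂ (g k)) z.1 u = μ * g k z) → u = 0) :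
    ∃ V : Set Ball, IsOpen V ∧ z ∈ V ∧
      ∀ w₁ ∈ V, ∀ w₂ ∈ V, (∃ c : ℂ, ∀ k, g k w₂ = c * g k w₁) → w₁ = w₂ := by
  have hgi' : extend ℂ (g i₀) z.1 ≠ 0 := by rwa [BallForms.extend_apply_coe]
  -- the ratio map and its strict derivative
  set ψ : (Fin 2 → ℂ) → (ι → ℂ) :=
    fun w k ↦ extend ℂ (g k) w * (extend ℂ (g i₀) w)⁻¹ with hψ
  have hψc : ContDiffAt ℂ 1 ψ z.1 :=
    contDiffAt_pi.2 fun k ↦ (contDiffAt_extend (hg k) z).mul ((contDiffAt_extend (hg i₀) z).inv hgi')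
  have hstrict : HasStrictFDerivAt ψ (fderiv ℂ ψ z.1) z.1 := hψc.hasStrictFDerivAt one_ne_zero
  set L := fderiv ℂ ψ z.1 with hL
  -- `L` is injective
  have hφd : ∀ k, DifferentiableAt ℂ (fun w ↦ extend ℂ (g k) w * (extend ℂ (g i₀) w)⁻¹) z.1 :=
    fun k ↦ (BallForms.differentiableAt_extend (hg _) z).mul
      ((BallForms.differentiableAt_extend (hg i₀) z).inv hgi')
  have hLinj : Function.Injective L := by
    refine (injective_iff_map_eq_zero _).2 fun u hu ↦ ?_
    have hk : ∀ k, fderiv ℂ (fun w ↦ extend ℂ (g k) w * (extend ℂ (g i₀) w)⁻¹) z.1 u = 0 := by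
      intro k
      have h1 := congrFun hu k
      rw [hL, hψ, fderiv_pi hφd] at h1
      simpa only [ContinuousLinearMap.pi_apply, Pi.zero_apply] using h1
    obtain ⟨μ, hμ⟩ := exists_eq_mul_of_fderiv_ratio_eq_zero hg z hgi hk
    exact himm u μ hμ
  obtain ⟨K, hK0, hK⟩ := (LinearMap.injective_iff_antilipschitz
    (L : (Fin 2 → ℂ) →ₗ[ℂ] (ι → ℂ))).1 hLinj
  -- `ψ` approximates `L` near `z`, hence is injective near `z`
  have hc : (K⁻¹ / 2 : NNReal) < K⁻¹ := NNReal.half_lt_self (inv_ne_zero hK0.ne')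
  obtain ⟨s, hs, happ⟩ := hstrict.approximates_deriv_on_nhds (c := K⁻¹ / 2)
    (Or.inr (by positivity))
  have hanti : AntilipschitzWith (K⁻¹ - K⁻¹ / 2)⁻¹ (s.restrict ψ) :=
    (hK.restrict s).add_sub_lipschitzWith happ.lipschitz_sub hc
  have hinj : Set.InjOn ψ s := Set.injOn_iff_injective.2 hanti.injective
  -- an open neighbourhood inside `s` on which `g_{i₀} ≠ 0`
  obtain ⟨s', hs's, hs'o, hzs'⟩ := mem_nhds_iff.1 hs
  refine ⟨{w : Ball | w.1 ∈ s'} ∩ {w : Ball | g i₀ w ≠ 0},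
    (hs'o.preimage continuous_subtype_val).inter
      (isOpen_ne_fun (BallForms.continuous_of_mem_holomorphic (hg i₀)) continuous_const),
    ⟨hzs', hgi⟩, fun w₁ hw₁ w₂ hw₂ ⟨c, hcw⟩ ↦ ?_⟩
  have h1 : g i₀ w₁ ≠ 0 := hw₁.2
  have h2 : g i₀ w₂ ≠ 0 := hw₂.2
  have hc0 : c ≠ 0 := by
    intro h0
    rw [hcw i₀, h0, zero_mul] at h2
    exact h2 rfl
  have heq : ψ w₁.1 = ψ w₂.1 := by
    funext k
    simp only [hψ, BallForms.extend_apply_coe, hcw k, hcw i₀, mul_inv]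
    field_simp
  exact Subtype.ext (hinj (hs's hw₁.1) (hs's hw₂.1) heq)

end ProjectiveMaps

/-! ### §5 Descent through the projection `𝔹² → Δ\𝔹²` -/

section Quotient

variable (Δ) [ProperlyDiscontinuousSMul Δ Ball] [IsCancelSMul Δ Ball]
variable {E' H' M' : Type*} [NormedAddCommGroup E'] [NormedSpace ℂ E'] [TopologicalSpace H']
  {I' : ModelWithCorners ℂ E' H'} [TopologicalSpace M'] [ChartedSpace H' M']

/-- **A map on `Δ\𝔹²` whose composite with the projection is holomorphic is holomorphic**: near
`Δ·z` it is the composite of the lift with the holomorphic local inverse of the projection.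
[cite: BergeronMillsonMoeglin2016Balls, Introduction §1.1] -/
theorem contMDiff_of_comp_mk {n : ℕ∞ω} {F : orbitRel.Quotient Δ Ball → M'} {Ft : Ball → M'}
    (hF : ∀ z, F (Literature.Geometry.Manifold.QuotientManifold.mk (G := Δ) z) = Ft z)
    (hFt : ContMDiff 𝓘(ℂ, Fin 2 → ℂ) I' n Ft) : ContMDiff 𝓘(ℂ, Fin 2 → ℂ) I' n F := by
  intro p
  obtain ⟨z, rfl⟩ := Quotient.exists_rep p
  have hld := BallModel.isLocalDiffeomorph_mk Δ z
  have hev : F =ᶠ[𝓝 (Literature.Geometry.Manifold.QuotientManifold.mk (G := Δ) z)]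
      Ft ∘ hld.localInverse := by
    filter_upwards [hld.localInverse_eventuallyEq_right] with y hy
    simp only [Function.comp_apply, id_eq] at hy ⊢
    rw [← hF, hy]
  exact ((hFt _).comp _ (hld.localInverse_contMDiffAt.of_le le_top)).congr_of_eventuallyEq hev

/-- **Immersions descend**: if `F ∘ mk = Ft`, `F` is differentiable at `Δ·z` and `dFt(z)` is injective,
then `dF(Δ·z)` is injective (the projection is a local biholomorphism, so `d(mk)(z)` is onto).
[cite: BergeronMillsonMoeglin2016Balls, Introduction §1.1] -/
theorem injective_mfderiv_of_comp_mk {F : orbitRel.Quotient Δ Ball → M'} {Ft : Ball → M'}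
    (hF : ∀ z, F (Literature.Geometry.Manifold.QuotientManifold.mk (G := Δ) z) = Ft z) (z : Ball)
    (hFd : MDifferentiableAt 𝓘(ℂ, Fin 2 → ℂ) I' F
      (Literature.Geometry.Manifold.QuotientManifold.mk (G := Δ) z))
    (hinj : Function.Injective (mfderiv 𝓘(ℂ, Fin 2 → ℂ) I' Ft z)) :
    Function.Injective (mfderiv 𝓘(ℂ, Fin 2 → ℂ) I' F
      (Literature.Geometry.Manifold.QuotientManifold.mk (G := Δ) z)) := by
  have hld := BallModel.isLocalDiffeomorph_mk Δ z
  have hmk : MDifferentiableAt 𝓘(ℂ, Fin 2 → ℂ) 𝓘(ℂ, Fin 2 → ℂ)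
      (Literature.Geometry.Manifold.QuotientManifold.mk (G := Δ) (M := Ball)) z :=
    hld.mdifferentiableAt (by simp)
  have hcomp : mfderiv 𝓘(ℂ, Fin 2 → ℂ) I' Ft z =
      (mfderiv 𝓘(ℂ, Fin 2 → ℂ) I' F (Literature.Geometry.Manifold.QuotientManifold.mk (G := Δ) z)).comp
        (mfderiv 𝓘(ℂ, Fin 2 → ℂ) 𝓘(ℂ, Fin 2 → ℂ)
          (Literature.Geometry.Manifold.QuotientManifold.mk (G := Δ) (M := Ball)) z) := by
    have hfun : Ft = F ∘ Literature.Geometry.Manifold.QuotientManifold.mk (G := Δ) (M := Ball) :=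
      funext fun w ↦ (hF w).symm
    rw [hfun]
    exact mfderiv_comp z hFd hmk
  set e := hld.mfderivToContinuousLinearEquiv (by simp) with he
  refine (injective_iff_map_eq_zero _).2 fun v hv ↦ ?_
  obtain ⟨u, rfl⟩ := e.surjective v
  have hu : mfderiv 𝓘(ℂ, Fin 2 → ℂ) I' Ft z u = 0 := by
    rw [hcomp]
    exact hv
  have hu0 : u = 0 := hinj (by rw [hu, map_zero])
  rw [hu0, map_zero]

/-- Points of `Δ\𝔹²` with different images under `F` are different; points with equal images have
representatives with equal images under the lift (bookkeeping form used for injectivity). [cite: BergeronMillsonMoeglin2016Balls, Introduction §1.1] -/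
theorem mk_eq_mk_iff_exists_smul (z w : Ball) :
    Literature.Geometry.Manifold.QuotientManifold.mk (G := Δ) z =
      Literature.Geometry.Manifold.QuotientManifold.mk (G := Δ) w ↔ ∃ δ : Δ, δ • w = z :=
  Literature.Geometry.Manifold.QuotientManifold.mk_eq_mk_iff

end Quotient

end BallProjective

end Literature.AlgebraicGeometry.ShimuraVarieties

end
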